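import Mathlib

/-!
# Two-body `T = 0` Gaussian domination: the exact criterion and a two-sided sandwich

Conjunct `BoseEinsteinCondensation` of `AtomisticToContinuum` — soloist report `paper/sharpest.md`
§4.10(viii) (rung 0 of conjecture (GD₀): the case `N = 1`, i.e. two particles).  Kernel form, in
an abstract inner product space, of the resolvent identity and the two operator inequalities that
decide free-constant Gaussian domination for a perturbed eigenvector.

Setting.  `K` ("kinetic") and `V` ("interaction") are symmetric linear maps, `V ≥ 0` as a form,
`z` a real spectral parameter with `K − z ≥ 0` as a form, `f` a unit vector with `K f = κ f`,
`h := K + V − z`.  The weak inverses are supplied as vectors: `u` with `h u = V f` and `w` with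
`(K − z) w = V f`.  Then `g := (κ − z)⁻¹ (f − u)` solves `h g = f`, and with
`χ := re⟨f, g⟩ = ⟨f, h⁻¹ f⟩`, `τ := re⟨f, V f⟩ − re⟨V f, u⟩ = ⟨f, T(z) f⟩`
(`T(z) = V − V h⁻¹ V`, the transition operator) and `σ := re⟨f, V f⟩ − re⟨V f, w⟩`
(`= ⟨f, (V − V (K−z)⁻¹ V) f⟩`, its second Born approximation):

* `SoloInformed.twoBody_weakInverse` — `h g = f`;
* `SoloInformed.twoBody_resolvent_identity` — `χ · (κ − z)² = (κ − z) − τ`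
  (i.e. `⟨f, h⁻¹ f⟩ = 1/(κ−z) − ⟨f, T(z) f⟩/(κ−z)²`);
* `SoloInformed.twoBody_born_le_transition` — `σ ≤ τ` (from `h⁻¹ ≤ (K − z)⁻¹`, proved on the
  vector `V f` by the variational characterisation, using only `V ≥ 0`, `K − z ≥ 0`);
* `SoloInformed.twoBody_transition_le_first` — `τ ≤ re⟨f, V f⟩` (from `h ≥ 0`);
* `SoloInformed.twoBody_domination_of_born` — **sufficient condition**: `0 < κ`, `z < κ` and
  `σ ≥ z (1 − z/κ)` imply `χ ≤ 1/κ` (Gaussian domination with the free constant);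
* `SoloInformed.twoBody_first_of_domination` — **necessary condition**: `χ ≤ 1/κ` implies
  `re⟨f, V f⟩ ≥ z (1 − z/κ)`.

Physical reading (torus `Λ`, lattice or continuum, pair potential `v ≥ 0`).  Two bosons, sector of
total momentum `k ≠ 0`; `K` = kinetic energy there (`≥ 2ε(k/2) > 0`), `V = v(x₁ − x₂) ≥ 0`,
`z = E₂ := E₀(N = 2)` (assumed `< inf K` on the sector, true once `|Λ| E₂ ≤ v̂(0)` is small against
`|Λ| ε(k)/2`), `f = (e_k ⊗ e_0 + e_0 ⊗ e_k)/√2 = a_k† Ψ₀^{(1)}`, `κ = ε(k)`.  Then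
`χ = χ₊(k)` of the report, `re⟨f, V f⟩ = (v̂(0) + v̂(k))/|Λ|` — Hartree plus EXCHANGE — and
`re⟨V f, w⟩ = S_k := (2|Λ|²)⁻¹ Σ_p |v̂(p) + v̂(p−k)|² / (ε(p) + ε(k−p) − E₂)`.  Hence the sandwich
`v̂(k) ≥ |Λ| S_k − (v̂(0) − |Λ|E₂) − |Λ|E₂²/ε(k) ⇒ χ₊(k) ε(k) ≤ 1 ⇒ v̂(k) ≥ −(v̂(0) − |Λ|E₂) − |Λ|E₂²/ε(k)`,
with `v̂(0) − |Λ| E₂ ≥ 0`: two-body free-constant domination is decided by the sign of the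
exchange energy `v̂(k)` up to second-order margins, in agreement with the exact-diagonalisation law
of the report (§4.10(vii)).  The `N`-body conjecture (GD₀) is the statement that the same holds with
`ρ v̂(k)` uniformly in `N` and `L`; nothing here bears on that uniformity.

References for the objects: transition operator and second resolvent identity — M. Reed, B. Simon,
*Methods of Modern Mathematical Physics* III §XI.6; operator monotonicity of the inverse —
folklore (Löwner).  The criterion itself I have not found in print (report §4.10(v),(viii)).
-/

noncomputable section

open Complex
open scoped InnerProductSpace ComplexConjugate

namespace Summit.AtomisticToContinuum.BoseEinsteinCondensation.Theorems

universe v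

variable {E : Type v} [NormedAddCommGroup E] [InnerProductSpace ℂ E]

section TwoBody

variable {K V : E →ₗ[ℂ] E} {f u w : E} {κ z : ℝ}

omit [NormedAddCommGroup E] [InnerProductSpace ℂ E] in
/-- `re((c : ℂ)⁻¹ w) = c⁻¹ re w` for real `c`. [folklore] -/
theorem SoloInformed.re_ofReal_inv_mul (c : ℝ) (w : ℂ) :
    (((c : ℂ))⁻¹ * w).re = c⁻¹ * w.re := by
  rw [← Complex.ofReal_inv, Complex.re_ofReal_mul]

/-- `re⟨x, y⟩ = re⟨y, x⟩`. [folklore] -/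
theorem SoloInformed.re_inner_comm (x y : E) : (⟪x, y⟫_ℂ).re = (⟪y, x⟫_ℂ).re := by
  rw [← inner_conj_symm, Complex.conj_re]

/-- `g := (κ − z)⁻¹ (f − u)` is a weak inverse: `(K + V − z) g = f`, given `K f = κ f`,
`(K + V − z) u = V f` and `κ ≠ z`. -/
theorem SoloInformed.twoBody_weakInverse (hKf : K f = (κ : ℂ) • f)
    (hu : K u + V u - (z : ℂ) • u = V f) (hκz : κ ≠ z) :
    K (((κ - z : ℝ) : ℂ)⁻¹ • (f - u)) + V (((κ - z : ℝ) : ℂ)⁻¹ • (f - u))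
      - (z : ℂ) • (((κ - z : ℝ) : ℂ)⁻¹ • (f - u)) = f := by
  have hne : ((κ - z : ℝ) : ℂ) ≠ 0 := by
    rw [Ne, Complex.ofReal_eq_zero]; exact sub_ne_zero.mpr hκz
  have hKu : K u = V f - V u + (z : ℂ) • u := by rw [← hu]; abel
  have key : K (f - u) + V (f - u) - (z : ℂ) • (f - u) = ((κ - z : ℝ) : ℂ) • f := by
    rw [map_sub, map_sub, hKf, hKu, smul_sub, Complex.ofReal_sub, sub_smul]
    abel
  rw [map_smul, map_smul, smul_comm (z : ℂ), ← smul_add, ← smul_sub, key, smul_smul,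
    inv_mul_cancel₀ hne, one_smul]

/-- **Resolvent identity in vector form**: with `τ := re⟨f, V f⟩ − re⟨V f, u⟩` (`= ⟨f, T(z) f⟩`),
`re⟨f, g⟩ · (κ − z)² = (κ − z) − τ` for `g = (κ−z)⁻¹ (f − u)`, i.e.
`⟨f, h⁻¹ f⟩ = 1/(κ−z) − ⟨f, T(z) f⟩/(κ−z)²`. [folklore: second resolvent identity] -/
theorem SoloInformed.twoBody_resolvent_identity
    (hK : ∀ x y : E, ⟪K x, y⟫_ℂ = ⟪x, K y⟫_ℂ) (hV : ∀ x y : E, ⟪V x, y⟫_ℂ = ⟪x, V y⟫_ℂ)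
    (hKf : K f = (κ : ℂ) • f) (hnorm : ‖f‖ = 1)
    (hu : K u + V u - (z : ℂ) • u = V f) (hκz : κ ≠ z) :
    (⟪f, ((κ - z : ℝ) : ℂ)⁻¹ • (f - u)⟫_ℂ).re * (κ - z) ^ 2
      = (κ - z) - ((⟪f, V f⟫_ℂ).re - (⟪V f, u⟫_ℂ).re) := by
  have hsub : (κ - z) ≠ 0 := sub_ne_zero.mpr hκz
  have hne : ((κ - z : ℝ) : ℂ) ≠ 0 := by rw [Ne, Complex.ofReal_eq_zero]; exact hsub
  -- ⟨f, h u⟩ = ⟨f, V f⟩ and ⟨f, h u⟩ = (κ - z)⟨f, u⟩ + ⟨V f, u⟩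
  have h1 : ⟪f, K u + V u - (z : ℂ) • u⟫_ℂ = ⟪f, V f⟫_ℂ := by rw [hu]
  have h2 : ⟪f, K u + V u - (z : ℂ) • u⟫_ℂ = ((κ - z : ℝ) : ℂ) * ⟪f, u⟫_ℂ + ⟪V f, u⟫_ℂ := by
    rw [inner_sub_right, inner_add_right, ← hK f u, ← hV f u, hKf, inner_smul_left,
      inner_smul_right, Complex.conj_ofReal, Complex.ofReal_sub]
    ring
  have h3 : ((κ - z : ℝ) : ℂ) * ⟪f, u⟫_ℂ = ⟪f, V f⟫_ℂ - ⟪V f, u⟫_ℂ := by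
    have := h1.symm.trans h2
    linear_combination -this
  -- real parts: (κ - z) re⟨f,u⟩ = re⟨f,Vf⟩ - re⟨Vf,u⟩
  have h3re : (κ - z) * (⟪f, u⟫_ℂ).re = (⟪f, V f⟫_ℂ).re - (⟪V f, u⟫_ℂ).re := by
    have := congrArg Complex.re h3
    rwa [Complex.re_ofReal_mul, Complex.sub_re] at this
  have hff : (⟪f, f⟫_ℂ).re = 1 := by
    have : ⟪f, f⟫_ℂ = ((‖f‖ : ℂ)) ^ 2 := inner_self_eq_norm_sq_to_K f
    rw [this, hnorm]; simp
  rw [inner_smul_right, SoloInformed.re_ofReal_inv_mul, inner_sub_right, Complex.sub_re, hff]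
  field_simp
  linear_combination (-1 : ℝ) * h3re

/-- **Second Born ≤ transition** (`V − V(K−z)⁻¹V ≤ T(z)` on the vector `f`): if `V ≥ 0` and
`K − z ≥ 0` as forms, `(K + V − z) u = V f` and `(K − z) w = V f`, then
`re⟨V f, u⟩ ≤ re⟨V f, w⟩`, i.e. `σ ≤ τ`.  (Operator monotonicity of the inverse,
`(K+V−z)⁻¹ ≤ (K−z)⁻¹`, by the variational characterisation.) [folklore] -/
theorem SoloInformed.twoBody_born_le_transition
    (hK : ∀ x y : E, ⟪K x, y⟫_ℂ = ⟪x, K y⟫_ℂ)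
    (hVpos : ∀ x : E, 0 ≤ (⟪x, V x⟫_ℂ).re)
    (hApos : ∀ x : E, 0 ≤ (⟪x, K x⟫_ℂ).re - z * ‖x‖ ^ 2)
    (hu : K u + V u - (z : ℂ) • u = V f) (hw : K w - (z : ℂ) • w = V f) :
    (⟪V f, u⟫_ℂ).re ≤ (⟪V f, w⟫_ℂ).re := by
  have nsq : ∀ x : E, ‖x‖ ^ 2 = (⟪x, x⟫_ℂ).re := fun x => by
    rw [← inner_self_eq_norm_sq (𝕜 := ℂ) x]; rfl
  -- the form of A := K - z
  have hAform : ∀ x : E, (⟪x, K x - (z : ℂ) • x⟫_ℂ).re = (⟪x, K x⟫_ℂ).re - z * ‖x‖ ^ 2 := by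
    intro x
    rw [inner_sub_right, inner_smul_right, Complex.sub_re, Complex.re_ofReal_mul, nsq]
  -- re⟨x, K y⟩ is symmetric
  have hKre : ∀ x y : E, (⟪x, K y⟫_ℂ).re = (⟪y, K x⟫_ℂ).re := by
    intro x y; rw [← hK x y, SoloInformed.re_inner_comm]
  -- names for the real numbers involved
  set a_uu := (⟪u, K u⟫_ℂ).re - z * ‖u‖ ^ 2 with ha_uu
  set a_ww := (⟪w, K w⟫_ℂ).re - z * ‖w‖ ^ 2 with ha_ww
  set a_uw := (⟪u, K w⟫_ℂ).re - z * (⟪u, w⟫_ℂ).re with ha_uw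
  -- ⟨Vf, u⟩ = a_uu + ⟨u, V u⟩
  have hyu : (⟪V f, u⟫_ℂ).re = a_uu + (⟪u, V u⟫_ℂ).re := by
    rw [← hu, inner_sub_left, inner_add_left, inner_smul_left, Complex.conj_ofReal,
      Complex.sub_re, Complex.add_re, Complex.re_ofReal_mul, SoloInformed.re_inner_comm (K u) u,
      SoloInformed.re_inner_comm (V u) u, ha_uu, nsq u]
    ring
  -- ⟨Vf, w⟩ = a_ww
  have hyw : (⟪V f, w⟫_ℂ).re = a_ww := by
    rw [← hw, inner_sub_left, inner_smul_left, Complex.conj_ofReal, Complex.sub_re,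
      Complex.re_ofReal_mul, SoloInformed.re_inner_comm (K w) w, ha_ww, nsq w]
  -- ⟨Vf, u⟩ = ⟨A w, u⟩ = a_uw
  have hyu' : (⟪V f, u⟫_ℂ).re = a_uw := by
    rw [← hw, inner_sub_left, inner_smul_left, Complex.conj_ofReal, Complex.sub_re,
      Complex.re_ofReal_mul, SoloInformed.re_inner_comm (K w) u, SoloInformed.re_inner_comm w u]
  -- positivity of A on (w - u): a_ww - 2 a_uw + a_uu ≥ 0
  have hpos : 0 ≤ a_ww - 2 * a_uw + a_uu := by
    have h0 := hApos (w - u)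
    have e1 : (⟪w - u, K (w - u)⟫_ℂ).re = (⟪w, K w⟫_ℂ).re - 2 * (⟪u, K w⟫_ℂ).re + (⟪u, K u⟫_ℂ).re := by
      rw [map_sub, inner_sub_left, inner_sub_right, inner_sub_right]
      simp only [Complex.sub_re]
      rw [hKre w u]; ring
    have e2 : ‖w - u‖ ^ 2 = ‖w‖ ^ 2 - 2 * (⟪u, w⟫_ℂ).re + ‖u‖ ^ 2 := by
      rw [nsq, nsq, nsq, inner_sub_left, inner_sub_right, inner_sub_right]
      simp only [Complex.sub_re]
      rw [SoloInformed.re_inner_comm w u]; ring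
    rw [e1, e2] at h0
    have : a_ww - 2 * a_uw + a_uu =
        (⟪w, K w⟫_ℂ).re - 2 * (⟪u, K w⟫_ℂ).re + (⟪u, K u⟫_ℂ).re
          - z * (‖w‖ ^ 2 - 2 * (⟪u, w⟫_ℂ).re + ‖u‖ ^ 2) := by
      rw [ha_ww, ha_uw, ha_uu]; ring
    rw [this]; exact h0
  have hVu := hVpos u
  -- a_ww ≥ 2 a_uw - a_uu = 2⟨y,u⟩ - (⟨y,u⟩ - ⟨u,Vu⟩) ≥ ⟨y,u⟩
  linarith [hyu, hyw, hyu', hpos, hVu]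

/-- **Transition ≤ first order** (`T(z) ≤ V` on `f`): `re⟨V f, u⟩ ≥ 0` when `K − z ≥ 0`, `V ≥ 0`
and `(K + V − z) u = V f`; hence `τ ≤ re⟨f, V f⟩`. [folklore] -/
theorem SoloInformed.twoBody_transition_le_first
    (hVpos : ∀ x : E, 0 ≤ (⟪x, V x⟫_ℂ).re)
    (hApos : ∀ x : E, 0 ≤ (⟪x, K x⟫_ℂ).re - z * ‖x‖ ^ 2)
    (hu : K u + V u - (z : ℂ) • u = V f) :
    0 ≤ (⟪V f, u⟫_ℂ).re := by
  have nsq : ‖u‖ ^ 2 = (⟪u, u⟫_ℂ).re := by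
    rw [← inner_self_eq_norm_sq (𝕜 := ℂ) u]; rfl
  have : (⟪V f, u⟫_ℂ).re = ((⟪u, K u⟫_ℂ).re - z * ‖u‖ ^ 2) + (⟪u, V u⟫_ℂ).re := by
    rw [← hu, inner_sub_left, inner_add_left, inner_smul_left, Complex.conj_ofReal,
      Complex.sub_re, Complex.add_re, Complex.re_ofReal_mul, SoloInformed.re_inner_comm (K u) u,
      SoloInformed.re_inner_comm (V u) u, nsq]
    abel
  rw [this]
  exact add_nonneg (hApos u) (hVpos u)

/-- **Two-body Gaussian domination from the second-Born condition.**  In the setting above, if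
`0 < κ`, `z < κ` and `σ := re⟨f, V f⟩ − re⟨V f, w⟩ ≥ z (1 − z/κ)`, then the resolvent expectation
`χ = re⟨f, g⟩`, `g = (κ−z)⁻¹(f − u) = h⁻¹ f`, satisfies `χ ≤ 1/κ`.  Physical reading: for two
bosons on a torus with `v ≥ 0`, `v̂(0) + v̂(k) − |Λ| S_k ≥ |Λ| E₂ (1 − E₂/ε(k))` implies
`χ₊(k) ≤ 1/ε(k)` (free-constant `T = 0` Gaussian domination at momentum `k`). [report §4.10(viii)] -/
theorem SoloInformed.twoBody_domination_of_born
    (hK : ∀ x y : E, ⟪K x, y⟫_ℂ = ⟪x, K y⟫_ℂ) (hV : ∀ x y : E, ⟪V x, y⟫_ℂ = ⟪x, V y⟫_ℂ)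
    (hVpos : ∀ x : E, 0 ≤ (⟪x, V x⟫_ℂ).re)
    (hApos : ∀ x : E, 0 ≤ (⟪x, K x⟫_ℂ).re - z * ‖x‖ ^ 2)
    (hKf : K f = (κ : ℂ) • f) (hnorm : ‖f‖ = 1)
    (hu : K u + V u - (z : ℂ) • u = V f) (hw : K w - (z : ℂ) • w = V f)
    (hκ : 0 < κ) (hzκ : z < κ)
    (hborn : z * (1 - z / κ) ≤ (⟪f, V f⟫_ℂ).re - (⟪V f, w⟫_ℂ).re) :
    (⟪f, ((κ - z : ℝ) : ℂ)⁻¹ • (f - u)⟫_ℂ).re ≤ 1 / κ := by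
  have hκz : κ ≠ z := (ne_of_lt hzκ).symm
  have hid := SoloInformed.twoBody_resolvent_identity hK hV hKf hnorm hu hκz
  have hmono := SoloInformed.twoBody_born_le_transition hK hVpos hApos hu hw
  set χ := (⟪f, ((κ - z : ℝ) : ℂ)⁻¹ • (f - u)⟫_ℂ).re with hχ
  set τ := (⟪f, V f⟫_ℂ).re - (⟪V f, u⟫_ℂ).re with hτ
  have hd : 0 < κ - z := sub_pos.mpr hzκ
  have h2 : 0 < (κ - z) ^ 2 := pow_pos hd 2
  -- τ ≥ σ ≥ z(1 - z/κ) = z(κ - z)/κ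
  have hτ_ge : z * (κ - z) / κ ≤ τ := by
    have : z * (1 - z / κ) = z * (κ - z) / κ := by field_simp
    linarith [hborn, hmono, this]
  -- χ (κ - z)² = (κ - z) - τ ≤ (κ - z) - z(κ - z)/κ = (κ - z)²/κ
  have h1 : χ * (κ - z) ^ 2 ≤ (κ - z) ^ 2 / κ := by
    rw [hid]
    have : (κ - z) - z * (κ - z) / κ = (κ - z) ^ 2 / κ := by field_simp
    linarith [hτ_ge, this]
  have h3 : χ ≤ ((κ - z) ^ 2 / κ) / (κ - z) ^ 2 := by
    rw [le_div_iff₀ h2]; exact h1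
  calc χ ≤ ((κ - z) ^ 2 / κ) / (κ - z) ^ 2 := h3
    _ = 1 / κ := by field_simp

/-- **Necessity of the first-order condition.**  If `χ ≤ 1/κ` (free-constant domination) then
`re⟨f, V f⟩ ≥ z (1 − z/κ)`.  Physical reading: two-body `T = 0` Gaussian domination at momentum
`k` forces `v̂(0) + v̂(k) ≥ |Λ| E₂ (1 − E₂/ε(k))`, i.e. it fails as soon as the exchange energy
`v̂(k)` is more negative than `−(v̂(0) − |Λ|E₂) − |Λ|E₂²/ε(k)`. [report §4.10(viii)] -/
theorem SoloInformed.twoBody_first_of_domination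
    (hK : ∀ x y : E, ⟪K x, y⟫_ℂ = ⟪x, K y⟫_ℂ) (hV : ∀ x y : E, ⟪V x, y⟫_ℂ = ⟪x, V y⟫_ℂ)
    (hVpos : ∀ x : E, 0 ≤ (⟪x, V x⟫_ℂ).re)
    (hApos : ∀ x : E, 0 ≤ (⟪x, K x⟫_ℂ).re - z * ‖x‖ ^ 2)
    (hKf : K f = (κ : ℂ) • f) (hnorm : ‖f‖ = 1)
    (hu : K u + V u - (z : ℂ) • u = V f)
    (hκ : 0 < κ) (hzκ : z < κ)
    (hGD : (⟪f, ((κ - z : ℝ) : ℂ)⁻¹ • (f - u)⟫_ℂ).re ≤ 1 / κ) :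
    z * (1 - z / κ) ≤ (⟪f, V f⟫_ℂ).re := by
  have hκz : κ ≠ z := (ne_of_lt hzκ).symm
  have hid := SoloInformed.twoBody_resolvent_identity hK hV hKf hnorm hu hκz
  have hT := SoloInformed.twoBody_transition_le_first hVpos hApos hu
  set χ := (⟪f, ((κ - z : ℝ) : ℂ)⁻¹ • (f - u)⟫_ℂ).re with hχ
  have hd : 0 < κ - z := sub_pos.mpr hzκ
  have h2 : 0 < (κ - z) ^ 2 := pow_pos hd 2
  -- (κ - z) - τ = χ (κ-z)² ≤ (κ-z)²/κ
  have h1 : χ * (κ - z) ^ 2 ≤ (κ - z) ^ 2 / κ := by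
    calc χ * (κ - z) ^ 2 ≤ (1 / κ) * (κ - z) ^ 2 := mul_le_mul_of_nonneg_right hGD h2.le
      _ = (κ - z) ^ 2 / κ := by ring
  rw [hid] at h1
  have h3 : (κ - z) - (κ - z) ^ 2 / κ = z * (1 - z / κ) := by field_simp; ring
  linarith [h1, hT, h3]

end TwoBody

end Summit.AtomisticToContinuum.BoseEinsteinCondensation.Theorems

end
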